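import Mathlib
import HarnessLib
import Summits.Ventures.LatticeQCDFlow.Scaling.TorusTransferOfLimits2D
import Summits.Ventures.LatticeQCDFlow.Scaling.TorusWindowEssLoss2D
import Summits.Ventures.LatticeQCDFlow.Scaling.AcceptanceAlongCouplingSequences

/-!
# LatticeQCDFlow / Scaling — THE WINDOW `β√V → c` ON THE TORUS: for every coupling sequence with
# `β_L·L → c > 0` (in particular `β = c/L`) the untrained sampler of 2-d Wilson lattice gauge theory on
# the periodic `L × L` torus has acceptance `→ erfc(cσ/2)`, `σ² = Var_Haar(Re tr ρ)`, every compact `G`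

HONEST FRAMING: exact (Metropolis-corrected) sampling algorithms for lattice gauge theory;
figures of merit are autocorrelation/cost numbers at stated couplings and volumes; no
continuum-physics claim.

Venture `LatticeQCDFlow` (cell pub-lqcd), topic `Scaling`; FANOUT row 3 (`s0-u1-a`, S0-B
implementation A, GEN-21).  NEW WORK of the cell, no numerics, NO definition.  `Scaling/TorusDiagonalLimit2D`
gave the torus law along the punctured diagonal `β_L = c/√(L² − 1)`; the natural parametrisation is
`β√V = c` with `V = L²` the number of plaquettes.  GEN-20's `Scaling/AcceptanceAlongCouplingSequences`
(`tiltPi_meanAccept_tendsto_of_sqrt_mul_tendsto`: the factorised `n`-block acceptance along ANY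
`β_n√n → c > 0` tends to `erfc(cσ/2)`) and GEN-21's transfer theorem
(`Scaling/TorusTransferOfLimits2D.torus_meanAccept_tendsto_of_tiltPi_tendsto`) give the torus law
along every sequence `β_k·(k + 2) → c > 0`, by re-parametrising the volume subsequence
`n_k = (k + 2)² − 1` (`Nat.sqrt` inverts it) :

* §1 `puncturedIndex_nk` (`Nat.sqrt(n_k + 1) − 2 = k`), `tendsto_puncturedIndex_atTop`,
  `tendsto_reparam_mul_sqrt` (the extended sequence `β̃_n√n` has the limit of `β_k√n_k`, any filter),
  `reparam_apply_nk` (with `tendsto_mul_sqrt_punctured` of `Scaling/TorusWindowEssLoss2D`, imported: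
  `β_k(k+2) → c ⇒ β_k√n_k → c`);
* §2 **`torus_meanAccept_tendsto_erfc_of_mul_tendsto`** — `β_k·(k+2) → c > 0`, `Var_Haar(Re tr ρ) ≠ 0`
  ⇒ `acc_T(k+2, β_k) → (2/√π)∫_{√(c²σ²)/2}^∞ e^{−u²} du`; **`torus_meanAccept_window_tendsto_erfc`** —
  the case `β_L = c/L`.

NOT CLAIMED: `c < 0` (symmetric); the endpoints of the window (`β_L·L → 0 ⇒ acc → 1`,
`→ ∞ ⇒ acc → 0`: GEN-19's `Scaling/IdentityFlowCouplingWindow`, transferable the same way); ESS / loss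
along general sequences; `d ≥ 3`; any value at the cell's `(β, L)`; nothing re-scored, SEALED.md
untouched.
-/

noncomputable section

namespace Summit.Ventures.LatticeQCDFlow.Theory2

open MeasureTheory ProbabilityTheory Filter Finset Real Set
open Literature.MathematicalPhysics.QuantumFieldTheory
open scoped Topology

/-! ## §1 Re-parametrising the punctured volumes -/

section Reparam

/-- `Nat.sqrt` inverts the punctured volume: `Nat.sqrt((k+2)² − 1 + 1) − 2 = k`. [folklore] -/
theorem puncturedIndex_nk (k : ℕ) : Nat.sqrt ((k + 2) ^ 2 - 1 + 1) - 2 = k := by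
  have h1 : 1 ≤ (k + 2) ^ 2 := Nat.one_le_pow _ _ (by omega)
  rw [Nat.sub_add_cancel h1, Nat.sqrt_eq']
  omega

/-- `Nat.sqrt(n + 1) − 2 → ∞`. [folklore] -/
theorem tendsto_puncturedIndex_atTop : Tendsto (fun n : ℕ => Nat.sqrt (n + 1) - 2) atTop atTop := by
  refine tendsto_atTop_atTop.2 fun b => ⟨(b + 2) ^ 2, fun n hn => ?_⟩
  have h : b + 2 ≤ Nat.sqrt (n + 1) := Nat.le_sqrt.2 (by nlinarith)
  omega

/-- **The extended coupling sequence.**  `β̃_n = β_{κ(n)}·√(n_{κ(n)})/√n`, `κ(n) = Nat.sqrt(n+1) − 2`,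
agrees with `β_k` at `n = n_k` and `β̃_n√n` has the limit of `β_k√n_k` (any limit filter: a real `c`,
`atTop`, …). [ours] -/
theorem tendsto_reparam_mul_sqrt {β : ℕ → ℝ} {l : Filter ℝ}
    (hβ : Tendsto (fun k : ℕ => β k * Real.sqrt ((((k + 2) ^ 2 - 1 : ℕ)) : ℝ)) atTop l) :
    Tendsto (fun n : ℕ => (β (Nat.sqrt (n + 1) - 2) *
        Real.sqrt ((((Nat.sqrt (n + 1) - 2 + 2) ^ 2 - 1 : ℕ)) : ℝ) / Real.sqrt n) * Real.sqrt n)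
      atTop l := by
  have h := hβ.comp tendsto_puncturedIndex_atTop
  refine (h.congr' ?_)
  filter_upwards [eventually_gt_atTop 0] with n hn
  have hs : Real.sqrt n ≠ 0 := (Real.sqrt_pos.2 (Nat.cast_pos.2 hn)).ne'
  simp only [Function.comp_apply]
  field_simp

/-- The extended sequence agrees with `β_k` on the subsequence `n_k = (k+2)² − 1`. [ours] -/
theorem reparam_apply_nk (β : ℕ → ℝ) (k : ℕ) :
    β (Nat.sqrt (((k + 2) ^ 2 - 1) + 1) - 2) *
        Real.sqrt ((((Nat.sqrt (((k + 2) ^ 2 - 1) + 1) - 2 + 2) ^ 2 - 1 : ℕ)) : ℝ) /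
          Real.sqrt ((((k + 2) ^ 2 - 1 : ℕ)) : ℝ) = β k := by
  rw [puncturedIndex_nk]
  have hpos : 0 < Real.sqrt ((((k + 2) ^ 2 - 1 : ℕ)) : ℝ) := by
    apply Real.sqrt_pos.2
    have h1 : 1 < (k + 2) ^ 2 := Nat.one_lt_pow two_ne_zero (by omega)
    exact Nat.cast_pos.2 (Nat.sub_pos_of_lt h1)
  rw [mul_div_assoc, div_self hpos.ne', mul_one]

end Reparam

/-! ## §2 The acceptance along `β_L·L → c` on the torus -/

section Window

variable {N : ℕ} {G : Type*} [Group G] [TopologicalSpace G] [IsTopologicalGroup G]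
  [CompactSpace G] [SecondCountableTopology G] [MeasurableSpace G] [BorelSpace G]
  (ρ : G →* Matrix (Fin N) (Fin N) ℂ)

/-- **THE TORUS ACCEPTANCE ALONG `β_L·L → c`.**  For every compact second-countable `G`, continuous `ρ`
with `Var_Haar(Re tr ρ) ≠ 0`, and couplings with `β_k·(k + 2) → c > 0`: the equilibrium acceptance of the
untrained exact sampler on the periodic `(k+2) × (k+2)` torus tends to
`(2/√π)∫_{√(c²σ²)/2}^∞ e^{−u²} du = erfc(cσ/2)`. [ours] -/
theorem torus_meanAccept_tendsto_erfc_of_mul_tendsto (hρ : Continuous ρ)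
    (hσ : Var[fun g : G => (ρ g).trace.re; haarProbability G] ≠ 0) {β : ℕ → ℝ} {c : ℝ} (hc : 0 < c)
    (hβ : Tendsto (fun k : ℕ => β k * ((k : ℝ) + 2)) atTop (𝓝 c)) :
    Tendsto (fun k : ℕ =>
        ∫ U, ∫ U', min
            (Real.exp (-β k * wilsonAction ρ U) /
              ∫ V, Real.exp (-β k * wilsonAction ρ V) ∂(Measure.pi fun _ : Edge 2 (k + 2) => haarProbability G))
            (Real.exp (-β k * wilsonAction ρ U') /
              ∫ V, Real.exp (-β k * wilsonAction ρ V) ∂(Measure.pi fun _ : Edge 2 (k + 2) => haarProbability G))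
          ∂(Measure.pi fun _ : Edge 2 (k + 2) => haarProbability G)
          ∂(Measure.pi fun _ : Edge 2 (k + 2) => haarProbability G))
      atTop (𝓝 (2 / Real.sqrt Real.pi *
        ∫ u in Ioi (Real.sqrt (c ^ 2 * Var[fun g : G => (ρ g).trace.re; haarProbability G]) / 2),
          Real.exp (-u ^ 2))) := by
  obtain ⟨hXm, hXb, hX0, hVar⟩ := centredTrace_facts ρ hρ
  set m : ℝ := ∫ h, (ρ h).trace.re ∂(haarProbability G) with hm
  have hσ' : Var[fun g : G => (ρ g).trace.re - m; haarProbability G] ≠ 0 := by rwa [hVar]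
  -- the extended sequence `β̃` along all block counts `n`
  set βt : ℕ → ℝ := fun n => β (Nat.sqrt (n + 1) - 2) *
    Real.sqrt ((((Nat.sqrt (n + 1) - 2 + 2) ^ 2 - 1 : ℕ)) : ℝ) / Real.sqrt n with hβt
  have hβt_lim : Tendsto (fun n : ℕ => βt n * Real.sqrt n) atTop (𝓝 c) :=
    tendsto_reparam_mul_sqrt (tendsto_mul_sqrt_punctured hβ)
  -- GEN-20's law along `β̃`, read on the subsequence `n_k`
  have hE := (tiltPi_meanAccept_tendsto_of_sqrt_mul_tendsto (ν := haarProbability G)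
    (g := fun g => (ρ g).trace.re - m) hXm hXb hX0 hσ' hc hβt_lim).comp tendsto_puncturedVolume_atTop
  rw [hVar] at hE
  have hagree : ∀ k : ℕ, βt ((k + 2) ^ 2 - 1) = β k := fun k => reparam_apply_nk β k
  have hE' : Tendsto (fun k : ℕ =>
      (∫ z, ∫ z', min (Real.exp (β k * ∑ i, ((ρ (z i)).trace.re - m)))
            (Real.exp (β k * ∑ i, ((ρ (z' i)).trace.re - m)))
          ∂(Measure.pi fun _ : Fin ((k + 2) ^ 2 - 1) => haarProbability G)
          ∂(Measure.pi fun _ : Fin ((k + 2) ^ 2 - 1) => haarProbability G)) /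
        ∫ z, Real.exp (β k * ∑ i, ((ρ (z i)).trace.re - m))
          ∂(Measure.pi fun _ : Fin ((k + 2) ^ 2 - 1) => haarProbability G)) atTop
      (𝓝 (2 / Real.sqrt Real.pi *
        ∫ u in Ioi (Real.sqrt (c ^ 2 * Var[fun g : G => (ρ g).trace.re; haarProbability G]) / 2),
          Real.exp (-u ^ 2))) := by
    refine hE.congr fun k => ?_
    simp only [Function.comp_apply, hagree]
  exact torus_meanAccept_tendsto_of_tiltPi_tendsto ρ hρ m (tendsto_zero_of_mul_tendsto hβ) hE'

/-- **THE WINDOW `β = c/L` ON THE TORUS**: at `β_L = c/L`, `c > 0`, the equilibrium acceptance of the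
untrained exact sampler on the periodic `L × L` torus (`L = k + 2 → ∞`) tends to
`(2/√π)∫_{√(c²σ²)/2}^∞ e^{−u²} du = erfc(cσ/2)`, `σ² = Var_Haar(Re tr ρ) ≠ 0`. [ours] -/
theorem torus_meanAccept_window_tendsto_erfc (hρ : Continuous ρ)
    (hσ : Var[fun g : G => (ρ g).trace.re; haarProbability G] ≠ 0) {c : ℝ} (hc : 0 < c) :
    Tendsto (fun k : ℕ =>
        ∫ U, ∫ U', min
            (Real.exp (-(c / ((k : ℝ) + 2)) * wilsonAction ρ U) /
              ∫ V, Real.exp (-(c / ((k : ℝ) + 2)) * wilsonAction ρ V)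
                ∂(Measure.pi fun _ : Edge 2 (k + 2) => haarProbability G))
            (Real.exp (-(c / ((k : ℝ) + 2)) * wilsonAction ρ U') /
              ∫ V, Real.exp (-(c / ((k : ℝ) + 2)) * wilsonAction ρ V)
                ∂(Measure.pi fun _ : Edge 2 (k + 2) => haarProbability G))
          ∂(Measure.pi fun _ : Edge 2 (k + 2) => haarProbability G)
          ∂(Measure.pi fun _ : Edge 2 (k + 2) => haarProbability G))
      atTop (𝓝 (2 / Real.sqrt Real.pi *
        ∫ u in Ioi (Real.sqrt (c ^ 2 * Var[fun g : G => (ρ g).trace.re; haarProbability G]) / 2),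
          Real.exp (-u ^ 2))) := by
  refine torus_meanAccept_tendsto_erfc_of_mul_tendsto ρ hρ hσ (β := fun k => c / ((k : ℝ) + 2)) hc ?_
  refine tendsto_const_nhds.congr fun k => ?_
  have hpos : (0 : ℝ) < (k : ℝ) + 2 := by positivity
  field_simp

end Window

end Summit.Ventures.LatticeQCDFlow.Theory2

end
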